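import Literature.Computability.Complexity.PaulPippengerSzemerediTrotter1983ClaimsComplete
import Literature.Computability.Complexity.PaulPippengerSzemerediTrotter1983Spec
import HarnessLib

/-!
# Williams's computation graph of a time-`t` computation and its evaluation with a guessed head-movement pattern (claim W)

R. R. Williams, *Simulating Time with Square-Root Space*, STOC 2025 [Williams2025], §3.2 "The Main
Result" (arXiv:2502.17779, pp. 8–11 of the arXiv text): the computation graph `G_{M',x}` of a
time-`t` multitape computation cut into time blocks of length `b` (nodes = (tape, time block),
edges `(h',i) → (h,j)` when `j = i+1` or the tape block accessed by `h'` in time block `i` is next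
accessed in time block `j`); its SUCCINCT ENCODING by the head movements `m_{(h,i)} ∈ {−1,0,1}`
("the numbers `m_{(h,i)}` alone already tell us the entire structure of the graph", Claims 3.4–3.5);
the time-block functions `F_{h,i}` at the nodes ("Functions At The Nodes", p. 10: propagate FAIL;
otherwise simulate `M'` for time block `i` from the given contents and CHECK that every head moves
consistently with the guessed `m_{(h',i)}`; output `content(h,i)` or FAIL); and the two properties
the enumeration over guesses `G'` rests on ("Graph Enumeration", p. 9, and "Finishing up", p. 11):

* if `G' ≠ G_{M',x}` the evaluation yields FAIL ("This incorrect head movement will be detected by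
  the function `F_{h,i}`, which will then output FAIL. This FAIL value will propagate to the root");
* if `G' = G_{M',x}` the root evaluates to the true `content(1,B)` ("can be proved formally by an
  induction on the nodes of `G'` in topological order").

## The stack-machine rendering (what is formalised)

The tree's machines are Mathlib's multi-STACK machines `Turing.FinTM2`, and the block decomposition
of their runs is the Paul–Pippenger–Szemerédi–Trotter toolkit `TM2Blocks` [PaulEtAl1983, §3]
(`PaulPippengerSzemerediTrotter1983{Blocks,Cells,Claims,ClaimsComplete}.lean`), which Williams
himself names as the model of his succinct encoding ("These observations are similar but not
identical to those used in the separation of NTIME[n] and DTIME[n], of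
Paul–Pippenger–Szemerédi–Trotter", §3.2 p. 8). In that toolkit a run from `c₀` is cut into time
blocks of `b` steps; stack `k` is cut into HEIGHT blocks of `β = blockβ tm b` cells (the analogue of
tape blocks: one time block moves a stack top by `< β`); time block `j` touches on stack `k` exactly
the height blocks `lo … hi` (`TM2Blocks.lo/hi`, at most two adjacent ones, `isWalk_blocks`) — so
**the guessed head-movement sequence `{m_{(h,i)}}` becomes a guessed WALK `g = (lo, hi)` per stack**
(`Walk`), codable in `O(1)` bits per (stack, time block) exactly as `m_{(h,i)}`; the edge relation
"last accessed in time block `i`" is `TM2Blocks.lastToucher`; `content(h,i)` becomes the block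
SUMMARY (`Summary`: control and heights at the block's end, extreme boundary heights, end contents
above the block's cut — the `BlockClaim` data of the PPST bricks); and `F_{h,i}` becomes `nodeFn`:
assemble the start contents above the cut from the touched height blocks delivered by the children,
re-simulate `b` steps, recompute the extreme heights and from them the touched blocks, and CHECK
that they equal the guess (Williams's "checks that … the tape head `h'` moves consistently with the
integer `m_{(h',i)}`") together with the static sanity checks (C1 a, r, f) of the bricks; output
the summary or FAIL (`none`). One node per time block carries all stacks at once (Williams has one
node per (tape, time block); the in-degree `≤ 2p` becomes `≤ 1 + 2|K|`).

* `WilliamsGraph.nodeFn` — the node function `F_j` under the guess `g`; `nodeFn_eq` splits it into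
  `Checks` and `outOf`.
* `WilliamsGraph.table`, `WilliamsGraph.dagVal` — evaluation of the computation graph in topological
  order under the guess `g` (children of node `j`: node `j − 1` and, per stack and touched height
  block, its last toucher according to `g`; a FAIL child makes the node FAIL); `dagVal_eq` is the
  one-step unfolding.
* `WilliamsGraph.trueWalk`, `WilliamsGraph.trueSummary` — `G_{M',x}` itself and the true contents.
* **`WilliamsGraph.claimW_sound`** — for EVERY guess `g`: a non-FAIL value of node `j` is the true
  summary of time block `j`, and `g` agrees with the true walk at `j` (hence, contrapositively,
  Williams's first bullet: a wrong guess below `j` makes node `j` FAIL, `dagVal_eq_none_of_ne`).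
* **`WilliamsGraph.claimW_complete`** — under the true walk no node fails and node `j` evaluates to
  the true summary (Williams's second bullet).
* **`WilliamsGraph.claimW`** — both together (the typed rung-R2 target "claim W" of cell pnp-ideate,
  seat p3, for the `DTIME_subset_DSPACE_sqrt` ladder, `TimeSpace.lean` pnp.S37).
* `WilliamsGraph.trueWalk_isWalk` — the guess ranges over walks (`IsWalk`: `≤ 2` adjacent height
  blocks moving by `≤ 1` per time block), i.e. over `O(t/b)`-bit strings (Williams: "every possible
  guess of `G_{M',x}` can be encoded in only `O(B)` bits").

Proofs: soundness of one node is the bricks' `correct_step` (a claim with the true start data that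
passes the local re-simulation check (C1) is fully correct) applied to a two-claim family built from
the node's input and output; completeness is the bricks' `condSim_trueClaims` / `true_run_eq_append`;
the global statements are strong inductions on `j` ("induction on the nodes in topological
order"), using that FAIL propagates forward (`dagVal_ne_none_of_lt`) and that `lastToucher j B`
depends only on the walk below `j` (the bricks' `TM2Blocks.lastToucher_congr`).

## What is NOT here

No machine: this file is the machine-free CORRECTNESS of the computation-graph evaluation. The
space-`O(b)` implementation of `nodeFn`, the implicit Tree Evaluation instance `R_{G'}` (unfolding
the DAG into a tree of height `B + 1`), the Cook–Mertz call (`CookMertzProcedure.lean`) and the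
enumeration over `t = n, n+1, …` and over all guesses — i.e. Williams's Thm 1.1 as the `DSPACE`
statement `DTIME_subset_DSPACE_sqrt` — are the machine layer, not in this file. Block-respecting
form (Williams Lemma 2.1, Hopcroft–Paul–Valiant) is not needed in the stack rendering: the PPST
height blocks with their pop/push margins (`blockβ`) play its role.

## References

* [Williams2025] R. R. Williams, *Simulating Time with Square-Root Space*, STOC 2025, 13–23, §3.2
  (computation graph, succinct encoding, Claims 3.4–3.5, "Functions At The Nodes", "Graph
  Enumeration", "Finishing up"); arXiv:2502.17779.
* [PaulEtAl1983] W. J. Paul, N. Pippenger, E. Szemerédi, W. T. Trotter, *On determinism versus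
  non-determinism and related problems*, FOCS 1983, 429–438, §3 (block summaries and their local
  checks; the tree's `TM2Blocks` bricks).
-/

namespace Literature.Computability.Complexity

open Turing Function
open TM2Blocks

namespace WilliamsGraph

variable {tm : FinTM2}

/-! ### The guessed graph, node values, node functions -/

/-- **A guessed walk** — the stack-machine form of Williams's guessed head-movement sequence
`{m_{(h,i)}}` / candidate graph `G'` (§3.2 "Succinct Graph Encoding"): for every stack `k` and time
block `j`, the claimed lowest and highest touched height block. [cite: Williams2025, §3.2] -/
structure Walk (tm : FinTM2) where
  /-- claimed lowest touched height block of stack `k` in time block `j` -/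
  lo : tm.K → ℕ → ℕ
  /-- claimed highest touched height block of stack `k` in time block `j` -/
  hi : tm.K → ℕ → ℕ

/-- **Start data of a time block**: control (label, internal state) and stack heights at its start
(Williams §3.2: "the state `q` of `M'` at the start of time block `i` … and the head positions of all
`p` tapes at the start of time block `i`"). [cite: Williams2025, §3.2] -/
structure Start (tm : FinTM2) where
  /-- label at the block's start (`none` once halted) -/
  l : Option tm.Λ
  /-- internal state at the block's start -/
  var : tm.σ
  /-- stack heights at the block's start -/
  ht : tm.K → ℕ

/-- **The value of a node of the computation graph** — Williams's `content(h,i)` (§3.2 "Contents of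
Nodes": "the state of `M'` and the head position of tape `h` at the end of time block `i`, and the
content of the tape block read by head `h` at the end of time block `i`"), for all stacks at once:
the SUMMARY of a time block — control and heights at its END, its extreme boundary heights, and its
end contents above its cut (the `BlockClaim` data of [PaulEtAl1983, §3]). [cite: Williams2025, §3.2] -/
structure Summary (tm : FinTM2) where
  /-- label at the block's end -/
  l : Option tm.Λ
  /-- internal state at the block's end -/
  var : tm.σ
  /-- stack heights at the block's end -/
  ht : tm.K → ℕ
  /-- minimal boundary height of each stack during the block -/
  mn : tm.K → ℕ
  /-- maximal boundary height of each stack during the block -/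
  mx : tm.K → ℕ
  /-- end contents of each stack above the block's cut (top first) -/
  efrag : ∀ k, List (tm.Γ k)

/-- The start data handed to the next time block (the edge `(h', j−1) → (h, j)`: "the state and head
position … at the end of time block `j−1` is passed to the start of time block `j`").
[cite: Williams2025, §3.2] -/
def Summary.toStart (s : Summary tm) : Start tm := ⟨s.l, s.var, s.ht⟩

/-- The start data of time block `0`: the initial configuration's control and heights (Williams's
source nodes `(h,0,i)` / `content(h,0,i)`). [cite: Williams2025, §3.2] -/
def initStart (c₀ : tm.Cfg) : Start tm := ⟨c₀.l, c₀.var, fun k => (c₀.stk k).length⟩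

open scoped Classical in
/-- **The node function of time block `j`** under the guess `g` — Williams's `F_{h,i}` (§3.2
"Functions At The Nodes": "attempts to simulate `M'` for time block `i`, using the given content
strings. While simulating, `F_{h,i}` checks that for all `h'`, the tape head `h'` moves consistently
with the integer `m_{(h',i)}` … If all heads move consistently … the output of `F_{h,i}` is set to be
`content(h,i)`. Otherwise, the output of `F_{h,i}` is FAIL"): assemble the start contents above the
cut `g.lo k j · β` from the touched height blocks `blk k B` (`B = g.lo k j … g.hi k j`, bottom-up
cells), re-simulate `b` steps from the truncated start configuration, recompute the extreme heights
and from them `loC/hiC`; CHECK they equal the guess and that the bricks' static conditions (C1 a, r,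
f) hold; output the summary, else FAIL (`none`). [cite: Williams2025, §3.2] -/
noncomputable def nodeFn (b : ℕ) (g : Walk tm) (j : ℕ) (prev : Start tm)
    (blk : (k : tm.K) → ℕ → List (tm.Γ k)) : Option (Summary tm) :=
  let β := blockβ tm b
  let cut : tm.K → ℕ := fun k => g.lo k j * β
  let frag : ∀ k, List (tm.Γ k) := fun k =>
    (((List.range (g.hi k j + 1 - g.lo k j)).map fun i => blk k (g.lo k j + i)).flatten).reverse
  let C : tm.Cfg := ⟨prev.l, prev.var, frag⟩
  let U : ℕ → tm.Cfg := run tm C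
  let mn : tm.K → ℕ := fun k =>
    cut k + (Finset.range (b + 1)).inf' (by simp) (fun t => ((U t).stk k).length)
  let mx : tm.K → ℕ := fun k =>
    cut k + (Finset.range (b + 1)).sup' (by simp) (fun t => ((U t).stk k).length)
  let cl : BlockClaim tm := ⟨prev.l, prev.var, prev.ht, mn, mx, frag, fun k => (U b).stk k⟩
  if (∀ k, cl.loC b k = g.lo k j ∧ cl.hiC b k = g.hi k j) ∧
      (∀ k, (frag k).length + cut k = prev.ht k) ∧
      (∀ k, 0 < g.lo k j →
        b * TM2Comp.machinePopBound tm + TM2Comp.machinePopBound tm ≤ (frag k).length) ∧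
      (∀ k, prev.ht k ≤ (g.hi k j + 1) * β)
  then some ⟨(U b).l, (U b).var, fun k => ((U b).stk k).length + cut k, mn, mx,
    fun k => (U b).stk k⟩
  else none

open scoped Classical in
/-- **The table of node values** `0 … j−1` of the computation graph under the guess `g`, filled in
topological order (Williams §3.2 "Finishing up": "induction on the nodes of `G'` in topological
order"; children of `j`: node `j−1` and, per stack and touched height block, its last toucher
according to `g` — all `< j`, the edges of §3.2 "Computation Graph"); a FAIL child makes the node
FAIL ("if some input string is a FAIL string, then `F_{h,i}` immediately outputs FAIL as well").
[cite: Williams2025, §3.2] -/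
noncomputable def table (c₀ : tm.Cfg) (b : ℕ) (g : Walk tm) : ℕ → (ℕ → Option (Summary tm))
  | 0 => fun _ => none
  | j + 1 =>
      let T := table c₀ b g j
      let prev : Option (Start tm) :=
        if j = 0 then some (initStart c₀) else (T (j - 1)).map Summary.toStart
      let child : (k : tm.K) → ℕ → Option (List (tm.Γ k)) := fun k B =>
        match lastToucher (g.lo k) (g.hi k) j B with
        | some i => (T i).map fun s => bpartAbove (blockβ tm b) (g.lo k i * blockβ tm b) B (s.efrag k)
        | none => some (bpart (blockβ tm b) B (c₀.stk k))
      Function.update T j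
        (prev.bind fun p =>
          if ∀ k B, g.lo k j ≤ B → B ≤ g.hi k j → (child k B).isSome then
            nodeFn b g j p (fun k B => (child k B).getD [])
          else none)

/-- **The value of node `j`** of the computation graph under the guess `g` (`none` = FAIL).
[cite: Williams2025, §3.2] -/
noncomputable def dagVal (c₀ : tm.Cfg) (b : ℕ) (g : Walk tm) (j : ℕ) : Option (Summary tm) :=
  table c₀ b g (j + 1) j

/-- **The true walk** of the run — Williams's `G_{M',x}` itself (`TM2Blocks.lo/hi`; an `IsWalk` per
stack by `isWalk_blocks`). [cite: Williams2025, §3.2] -/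
noncomputable def trueWalk (c₀ : tm.Cfg) (b : ℕ) : Walk tm :=
  ⟨fun k j => lo tm c₀ b k j, fun k j => hi tm c₀ b k j⟩

/-- **The true summary of time block `j`** — Williams's true `content(·, j)` (cf.
`TM2Blocks.trueClaims` of [PaulEtAl1983, §3]). [cite: Williams2025, §3.2] -/
noncomputable def trueSummary (c₀ : tm.Cfg) (b j : ℕ) : Summary tm :=
  ⟨(run tm c₀ ((j + 1) * b)).l, (run tm c₀ ((j + 1) * b)).var,
    fun k => ((run tm c₀ ((j + 1) * b)).stk k).length,
    fun k => minH tm c₀ b k j, fun k => maxH tm c₀ b k j,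
    fun k => above (lo tm c₀ b k j * blockβ tm b) ((run tm c₀ ((j + 1) * b)).stk k)⟩

/-- **The guess ranges over walks** (Williams §3.2 "Succinct Graph Encoding": "every possible guess
of `G_{M',x}` can be encoded in only `O(B)` bits: we only need a constant number of bits for each of
the `O(B)` nodes"): the true walk of every stack is an `IsWalk` — ranges of `≤ 2` adjacent height
blocks moving by `≤ 1` per time block. [cite: Williams2025, §3.2] -/
theorem trueWalk_isWalk (c₀ : tm.Cfg) (b N : ℕ) (k : tm.K) :
    IsWalk ((trueWalk c₀ b).lo k) ((trueWalk c₀ b).hi k) N :=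
  isWalk_blocks c₀ b k N

/-! ### Unfolding the table (bookkeeping for the topological-order evaluation of §3.2) -/

section Structural

open scoped Classical in
/-- Entries below `n` are unchanged by the step to `n + 1` (topological order). [cite: Williams2025, §3.2] -/
theorem table_succ_of_lt (c₀ : tm.Cfg) (b : ℕ) (g : Walk tm) {n i : ℕ} (h : i < n) :
    table c₀ b g (n + 1) i = table c₀ b g n i := by
  rw [table]
  dsimp only
  rw [Function.update_apply, if_neg (Nat.ne_of_lt h)]

/-- Every table of length `n > i` holds the value of node `i`. [cite: Williams2025, §3.2] -/
theorem table_eq_dagVal (c₀ : tm.Cfg) (b : ℕ) (g : Walk tm) :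
    ∀ n i, i < n → table c₀ b g n i = dagVal c₀ b g i := by
  intro n
  induction n with
  | zero => intro i hi; exact absurd hi (Nat.not_lt_zero _)
  | succ n ih =>
      intro i hi
      rcases Nat.lt_succ_iff_lt_or_eq.1 hi with h | rfl
      · rw [table_succ_of_lt c₀ b g h]; exact ih i h
      · rfl

/-- **The children lookups of node `j`** (the edges into time block `j` other than `j−1`: per stack
and touched height block `B`, the end contents of its last toucher according to `g`, or the initial
contents if never touched — Williams's edges `(h',i) → (h,j)` and `(h',0,i) → (h,j)`, §3.2
"Computation Graph"). [cite: Williams2025, §3.2] -/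
noncomputable def childT (c₀ : tm.Cfg) (b : ℕ) (g : Walk tm) (j : ℕ) (k : tm.K) (B : ℕ) :
    Option (List (tm.Γ k)) :=
  match lastToucher (g.lo k) (g.hi k) j B with
  | some i => (table c₀ b g j i).map fun s =>
      bpartAbove (blockβ tm b) (g.lo k i * blockβ tm b) B (s.efrag k)
  | none => some (bpart (blockβ tm b) B (c₀.stk k))

/-- **The start-data lookup of node `j`** (the edge `(·, j−1) → (·, j)`, or the initial configuration
for `j = 0`). [cite: Williams2025, §3.2] -/
noncomputable def prevT (c₀ : tm.Cfg) (b : ℕ) (g : Walk tm) (j : ℕ) : Option (Start tm) :=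
  if j = 0 then some (initStart c₀) else (table c₀ b g j (j - 1)).map Summary.toStart

open scoped Classical in
/-- **One-step unfolding of the node value**: node `j` FAILs if its predecessor or a needed child
FAILs, and otherwise is `F_j` applied to the delivered data. [cite: Williams2025, §3.2] -/
theorem dagVal_eq (c₀ : tm.Cfg) (b : ℕ) (g : Walk tm) (j : ℕ) :
    dagVal c₀ b g j = (prevT c₀ b g j).bind fun p =>
      if ∀ k B, g.lo k j ≤ B → B ≤ g.hi k j → (childT c₀ b g j k B).isSome then
        nodeFn b g j p (fun k B => (childT c₀ b g j k B).getD [])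
      else none := by
  unfold dagVal prevT childT
  rw [table]
  dsimp only
  rw [Function.update_apply, if_pos rfl]

/-- Node `0` starts from the initial configuration. [cite: Williams2025, §3.2] -/
theorem prevT_zero (c₀ : tm.Cfg) (b : ℕ) (g : Walk tm) : prevT c₀ b g 0 = some (initStart c₀) := by
  simp [prevT]

/-- Node `m + 1` starts from the value of node `m`. [cite: Williams2025, §3.2] -/
theorem prevT_succ (c₀ : tm.Cfg) (b : ℕ) (g : Walk tm) (m : ℕ) :
    prevT c₀ b g (m + 1) = (dagVal c₀ b g m).map Summary.toStart := by
  simp only [prevT, Nat.succ_ne_zero, if_false, Nat.add_sub_cancel]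
  rw [table_eq_dagVal c₀ b g (m + 1) m (Nat.lt_succ_self m)]

/-- A touched height block with a last toucher `i` is read off the value of node `i`.
[cite: Williams2025, §3.2] -/
theorem childT_of_some (c₀ : tm.Cfg) (b : ℕ) (g : Walk tm) {j : ℕ} {k : tm.K} {B i : ℕ}
    (h : lastToucher (g.lo k) (g.hi k) j B = some i) :
    childT c₀ b g j k B = (dagVal c₀ b g i).map fun s =>
      bpartAbove (blockβ tm b) (g.lo k i * blockβ tm b) B (s.efrag k) := by
  unfold childT
  rw [h]
  dsimp only
  rw [table_eq_dagVal c₀ b g j i (lastToucher_spec h).1]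

/-- A never-touched height block is read off the initial configuration (source node `(h,0,i)`).
[cite: Williams2025, §3.2] -/
theorem childT_of_none (c₀ : tm.Cfg) (b : ℕ) (g : Walk tm) {j : ℕ} {k : tm.K} {B : ℕ}
    (h : lastToucher (g.lo k) (g.hi k) j B = none) :
    childT c₀ b g j k B = some (bpart (blockβ tm b) B (c₀.stk k)) := by
  unfold childT
  rw [h]

/-- **FAIL propagates forward**: a non-FAIL node has a non-FAIL predecessor ("a single FAIL detection
at any node will propagate to the root value"). [cite: Williams2025, §3.2] -/
theorem dagVal_ne_none_of_succ (c₀ : tm.Cfg) (b : ℕ) (g : Walk tm) (m : ℕ)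
    (h : dagVal c₀ b g (m + 1) ≠ none) : dagVal c₀ b g m ≠ none := by
  intro hm
  apply h
  rw [dagVal_eq, prevT_succ, hm]
  rfl

/-- FAIL propagates forward: a non-FAIL node has non-FAIL values at all earlier nodes.
[cite: Williams2025, §3.2] -/
theorem dagVal_ne_none_of_lt (c₀ : tm.Cfg) (b : ℕ) (g : Walk tm) {j : ℕ}
    (h : dagVal c₀ b g j ≠ none) : ∀ m, m < j → dagVal c₀ b g m ≠ none := by
  induction j with
  | zero => intro m hm; exact absurd hm (Nat.not_lt_zero _)
  | succ j ih =>
      intro m hm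
      have hj := dagVal_ne_none_of_succ c₀ b g j h
      rcases Nat.lt_succ_iff_lt_or_eq.1 hm with hm | rfl
      · exact ih hj m hm
      · exact hj

end Structural

/-! ### List lemmas: assembling a top segment from height blocks -/

section Lists

variable {α : Type}

/-- Concatenating `n` consecutive chunks of length `β` starting at offset `a`. [folklore] -/
private theorem flatten_chunks (R : List α) (β a : ℕ) : ∀ n : ℕ,
    ((List.range n).map fun i => (R.drop (a + i * β)).take β).flatten = (R.drop a).take (n * β)
  | 0 => by simp
  | n + 1 => by
      rw [List.range_succ, List.map_append, List.flatten_append, flatten_chunks R β a n,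
        List.map_singleton, List.flatten_singleton, Nat.succ_mul, List.take_add]
      congr 1
      rw [List.drop_drop]

/-- Dropping `θ` bottom cells (stack words are top first). [folklore] -/
private theorem reverse_drop_reverse (S : List α) (θ : ℕ) :
    (S.reverse.drop θ).reverse = S.take (S.length - θ) := by
  conv_lhs => rw [← List.take_append_drop (S.length - θ) S]
  rw [List.reverse_append, drop_append_of_length_le _ _ (by simp; omega)]
  rcases (le_or_gt θ S.length) with h | h
  · have : θ - (List.drop (S.length - θ) S).reverse.length = 0 := by simp; omega
    rw [this, List.drop_zero, List.reverse_reverse]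
  · have : S.length - θ = 0 := by omega
    rw [this]
    simp

/-- **Assembling the touched height blocks gives the start contents above the cut**: the height
blocks `lo … hi` of a stack word (bottom-up cells, then reversed) form its top segment above
`lo · β`, provided nothing sits above block `hi` (Williams §3.2: the contents `c_1, …, c_p` "for
each of the `p` tapes at the start of time block `i`" are assembled from the children's blocks).
[cite: Williams2025, §3.2] -/
theorem assemble_eq_above (S : List α) {β lo hi : ℕ} (hcov : S.length ≤ (hi + 1) * β) :
    (((List.range (hi + 1 - lo)).map fun i => bpart β (lo + i) S).flatten).reverse =
      above (lo * β) S := by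
  have h1 : ((List.range (hi + 1 - lo)).map fun i => bpart β (lo + i) S).flatten =
      (S.reverse.drop (lo * β)).take ((hi + 1 - lo) * β) := by
    have := flatten_chunks S.reverse β (lo * β) (hi + 1 - lo)
    simpa [bpart, Nat.add_mul] using this
  rw [h1, List.take_of_length_le, reverse_drop_reverse]
  · rfl
  · rw [List.length_drop, List.length_reverse, Nat.sub_mul]
    exact Nat.sub_le_sub_right hcov _

end Lists

/-! ### The node function decomposed -/

section Node

/-- The start contents above the cut assembled from the delivered height blocks (first step of
`F_j`). [cite: Williams2025, §3.2] -/
noncomputable def fragOf (g : Walk tm) (j : ℕ) (blk : (k : tm.K) → ℕ → List (tm.Γ k)) :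
    ∀ k, List (tm.Γ k) := fun k =>
  (((List.range (g.hi k j + 1 - g.lo k j)).map fun i => blk k (g.lo k j + i)).flatten).reverse

/-- The truncated start configuration `F_j` re-simulates from ("simulating `M'` for `b(n)` steps,
starting from the contents `c_1, …, c_p` … and the state and head information given").
[cite: Williams2025, §3.2] -/
noncomputable def startOf (g : Walk tm) (j : ℕ) (prev : Start tm)
    (blk : (k : tm.K) → ℕ → List (tm.Γ k)) : tm.Cfg :=
  ⟨prev.l, prev.var, fragOf g j blk⟩

/-- The recomputed minimal boundary height of each stack over the re-simulated block (lifted by the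
cut). [cite: Williams2025, §3.2] -/
noncomputable def mnOf (b : ℕ) (g : Walk tm) (j : ℕ) (prev : Start tm)
    (blk : (k : tm.K) → ℕ → List (tm.Γ k)) : tm.K → ℕ := fun k =>
  g.lo k j * blockβ tm b +
    (Finset.range (b + 1)).inf' (by simp) (fun t => ((run tm (startOf g j prev blk) t).stk k).length)

/-- The recomputed maximal boundary height of each stack over the re-simulated block (lifted by the
cut). [cite: Williams2025, §3.2] -/
noncomputable def mxOf (b : ℕ) (g : Walk tm) (j : ℕ) (prev : Start tm)
    (blk : (k : tm.K) → ℕ → List (tm.Γ k)) : tm.K → ℕ := fun k =>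
  g.lo k j * blockβ tm b +
    (Finset.range (b + 1)).sup' (by simp) (fun t => ((run tm (startOf g j prev blk) t).stk k).length)

/-- The block claim (in the sense of the PPST bricks) that node `j` implicitly makes from its input.
[cite: Williams2025, §3.2] -/
noncomputable def claimOf (b : ℕ) (g : Walk tm) (j : ℕ) (prev : Start tm)
    (blk : (k : tm.K) → ℕ → List (tm.Γ k)) : BlockClaim tm :=
  ⟨prev.l, prev.var, prev.ht, mnOf b g j prev blk, mxOf b g j prev blk, fragOf g j blk,
    fun k => (run tm (startOf g j prev blk) b).stk k⟩

/-- **The checks of `F_j`** ("checks that for all `h'`, the tape head `h'` moves consistently with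
the integer `m_{(h',i)}`"): the recomputed touched height blocks equal the guess, and the bricks'
static conditions — start contents fit the start heights above the cut (C1 a), static pop room
above a positive cut (C1 r), start height covered by the claimed blocks (C1 f). [cite: Williams2025, §3.2] -/
def Checks (b : ℕ) (g : Walk tm) (j : ℕ) (prev : Start tm)
    (blk : (k : tm.K) → ℕ → List (tm.Γ k)) : Prop :=
  (∀ k, (claimOf b g j prev blk).loC b k = g.lo k j ∧ (claimOf b g j prev blk).hiC b k = g.hi k j) ∧
  (∀ k, (fragOf g j blk k).length + g.lo k j * blockβ tm b = prev.ht k) ∧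
  (∀ k, 0 < g.lo k j →
    b * TM2Comp.machinePopBound tm + TM2Comp.machinePopBound tm ≤ (fragOf g j blk k).length) ∧
  (∀ k, prev.ht k ≤ (g.hi k j + 1) * blockβ tm b)

/-- **The output of `F_j` when the checks pass**: the summary of the re-simulated block ("the output
of `F_{h,i}` is set to be `content(h,i)`"). [cite: Williams2025, §3.2] -/
noncomputable def outOf (b : ℕ) (g : Walk tm) (j : ℕ) (prev : Start tm)
    (blk : (k : tm.K) → ℕ → List (tm.Γ k)) : Summary tm :=
  ⟨(run tm (startOf g j prev blk) b).l, (run tm (startOf g j prev blk) b).var,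
    fun k => ((run tm (startOf g j prev blk) b).stk k).length + g.lo k j * blockβ tm b,
    mnOf b g j prev blk, mxOf b g j prev blk, fun k => (run tm (startOf g j prev blk) b).stk k⟩

open scoped Classical in
/-- `F_j = if Checks then output else FAIL`. [cite: Williams2025, §3.2] -/
theorem nodeFn_eq (b : ℕ) (g : Walk tm) (j : ℕ) (prev : Start tm)
    (blk : (k : tm.K) → ℕ → List (tm.Γ k)) :
    nodeFn b g j prev blk = if Checks b g j prev blk then some (outOf b g j prev blk) else none := by
  unfold nodeFn Checks outOf claimOf mnOf mxOf startOf fragOf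
  dsimp only
  congr 1

end Node

/-! ### Soundness of one node -/

section Sound

/-- **The true start data of time block `j`.** [cite: Williams2025, §3.2] -/
noncomputable def trueStart (c₀ : tm.Cfg) (b j : ℕ) : Start tm :=
  ⟨(run tm c₀ (j * b)).l, (run tm c₀ (j * b)).var, fun k => ((run tm c₀ (j * b)).stk k).length⟩

/-- The induction hypothesis of the topological-order induction: all nodes below `j` evaluate to
the true summaries and the guess is the true walk there. [cite: Williams2025, §3.2] -/
def GoodBelow (c₀ : tm.Cfg) (b : ℕ) (g : Walk tm) (j : ℕ) : Prop :=
  ∀ m, m < j → dagVal c₀ b g m = some (trueSummary c₀ b m) ∧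
    ∀ k, g.lo k m = lo tm c₀ b k m ∧ g.hi k m = hi tm c₀ b k m

/-- Reading a touched height block off the true end segment of its last toucher (the edge
`(h',i) → (h,j)` delivers the right tape block). [cite: Williams2025, §3.2] -/
theorem efrag_true_bpart (c₀ : tm.Cfg) (b : ℕ) (k : tm.K) (i B : ℕ) (hB : lo tm c₀ b k i ≤ B) :
    bpartAbove (blockβ tm b) (lo tm c₀ b k i * blockβ tm b) B
        (above (lo tm c₀ b k i * blockβ tm b) ((run tm c₀ ((i + 1) * b)).stk k))
      = bpart (blockβ tm b) B ((run tm c₀ ((i + 1) * b)).stk k) := by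
  have hcut : lo tm c₀ b k i * blockβ tm b ≤ ((run tm c₀ ((i + 1) * b)).stk k).length := by
    have h1 := height_block_ge_minH c₀ b k i b le_rfl
    rw [show i * b + b = (i + 1) * b by ring] at h1
    rcases Nat.eq_zero_or_pos (lo tm c₀ b k i) with hz | hz
    · rw [hz]; simp
    · have := loβ_add_le_minH c₀ b k i hz; omega
  conv_rhs => rw [← above_append_below (lo tm c₀ b k i * blockβ tm b)
    ((run tm c₀ ((i + 1) * b)).stk k)]
  rw [bpart_append_eq_bpartAbove _ _ (length_below hcut) (Nat.mul_le_mul_right _ hB)]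

/-- Under goodness below `j`, every child lookup of node `j` delivers the TRUE content of its height
block at the start of time block `j` (last toucher's end content = content at `j`'s start, by the
bricks' `bpart_run_eq_of_lastToucher`; untouched = initial). [cite: Williams2025, §3.2] -/
theorem childT_eq_true {c₀ : tm.Cfg} {b : ℕ} {g : Walk tm} {j : ℕ} (hG : GoodBelow c₀ b g j)
    (k : tm.K) (B : ℕ) :
    childT c₀ b g j k B = some (bpart (blockβ tm b) B ((run tm c₀ (j * b)).stk k)) := by
  have hcongr : lastToucher (g.lo k) (g.hi k) j B =
      lastToucher (lo tm c₀ b k) (hi tm c₀ b k) j B :=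
    lastToucher_congr (fun m hm => (hG m hm).2 k) B
  rcases hlt : lastToucher (lo tm c₀ b k) (hi tm c₀ b k) j B with _ | i
  · rw [childT_of_none c₀ b g (hcongr.trans hlt), bpart_run_eq_init_of_lastToucher_none c₀ b k hlt]
  · have hg := hcongr.trans hlt
    obtain ⟨hij, htouch, -⟩ := lastToucher_spec hlt
    rw [childT_of_some c₀ b g hg, (hG i hij).1, ((hG i hij).2 k).1,
      bpart_run_eq_of_lastToucher c₀ b k hlt]
    exact congrArg some (efrag_true_bpart c₀ b k i B htouch.1)

/-- Under goodness below `j`, node `j` receives the true start data. [cite: Williams2025, §3.2] -/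
theorem prevT_eq_true {c₀ : tm.Cfg} {b : ℕ} {g : Walk tm} {j : ℕ} (hG : GoodBelow c₀ b g j) :
    prevT c₀ b g j = some (trueStart c₀ b j) := by
  rcases j with _ | m
  · rw [prevT_zero]
    simp [trueStart, initStart, run]
  · rw [prevT_succ, (hG m (Nat.lt_succ_self m)).1]
    rfl

/-- With the true blocks delivered and the start height covered by the guessed blocks, the assembled
start contents are the true contents above the guessed cut. [cite: Williams2025, §3.2] -/
theorem fragOf_eq_above {c₀ : tm.Cfg} {b : ℕ} {g : Walk tm} {j : ℕ}
    (blk : (k : tm.K) → ℕ → List (tm.Γ k))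
    (hblk : ∀ k B, blk k B = bpart (blockβ tm b) B ((run tm c₀ (j * b)).stk k))
    (hcov : ∀ k, ((run tm c₀ (j * b)).stk k).length ≤ (g.hi k j + 1) * blockβ tm b) (k : tm.K) :
    fragOf g j blk k = above (g.lo k j * blockβ tm b) ((run tm c₀ (j * b)).stk k) := by
  unfold fragOf
  simp_rw [hblk]
  exact assemble_eq_above _ (hcov k)

/-- **Node soundness** ("This incorrect head movement will be detected by the function `F_{h,i}`"):
from the true start data and the true touched blocks, a node that passes its checks outputs the
true summary, and its guessed `lo/hi` are the true ones. Proof: the bricks' `correct_step`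
([PaulEtAl1983, §3]: a claim with the true start data satisfying the local re-simulation check (C1)
is fully correct) on the two-claim family (node `j`'s implicit claim, its output).
[cite: Williams2025, §3.2] -/
theorem node_sound {c₀ : tm.Cfg} {b : ℕ} {g : Walk tm} {j : ℕ}
    (blk : (k : tm.K) → ℕ → List (tm.Γ k))
    (hblk : ∀ k B, blk k B = bpart (blockβ tm b) B ((run tm c₀ (j * b)).stk k))
    (hC : Checks b g j (trueStart c₀ b j) blk) :
    outOf b g j (trueStart c₀ b j) blk = trueSummary c₀ b j ∧
      ∀ k, g.lo k j = lo tm c₀ b k j ∧ g.hi k j = hi tm c₀ b k j := by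
  letI := tm.kDecidableEq
  obtain ⟨h1, h2, h3, h4⟩ := hC
  have hfrag : ∀ k, fragOf g j blk k =
      above (g.lo k j * blockβ tm b) ((run tm c₀ (j * b)).stk k) :=
    fragOf_eq_above blk hblk (fun k => h4 k)
  set cl := claimOf b g j (trueStart c₀ b j) blk with hcl
  set U : ℕ → tm.Cfg := run tm (startOf g j (trueStart c₀ b j) blk) with hU
  let nx : BlockClaim tm :=
    ⟨(U b).l, (U b).var, fun k => ((U b).stk k).length + g.lo k j * blockβ tm b,
      fun _ => 0, fun _ => 0, fun _ => [], fun _ => []⟩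
  set Γ : ℕ → BlockClaim tm := fun m => if m = j then cl else nx with hΓ
  have hΓj : Γ j = cl := by simp [hΓ]
  have hΓj1 : Γ (j + 1) = nx := by simp [hΓ]
  have hcut : ∀ k, cl.cutC b k = g.lo k j * blockβ tm b := fun k => by
    show cl.loC b k * blockβ tm b = _
    rw [(h1 k).1]
  have hstart : cl.startCfg = startOf g j (trueStart c₀ b j) blk := rfl
  have hcorr : Correct c₀ b Γ j := by
    unfold Correct
    rw [hΓj]
    refine ⟨rfl, rfl, fun k => rfl, fun k => ?_⟩
    rw [hcut]
    exact hfrag k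
  have hsim : CondSim b Γ j := by
    unfold CondSim
    rw [hΓj, hΓj1]
    dsimp only
    rw [hstart]
    refine ⟨fun k => ?_, fun k hk => ?_, ⟨rfl, rfl⟩, fun k => ?_, fun k => rfl,
      fun k => ⟨?_, ?_, ?_, ?_⟩, fun k => ?_⟩
    · rw [hcut]; exact h2 k
    · rw [(h1 k).1] at hk; exact h3 k hk
    · rw [hcut]
    · intro t ht
      rw [hcut]
      show g.lo k j * blockβ tm b + (Finset.range (b + 1)).inf' _ _ ≤ _
      exact Nat.add_le_add_left (Finset.inf'_le _ (by simpa [Nat.lt_succ_iff] using ht)) _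
    · obtain ⟨t, ht, heq⟩ := Finset.exists_mem_eq_inf' (s := Finset.range (b + 1)) (by simp)
        (fun t => ((U t).stk k).length)
      refine ⟨t, by simpa [Nat.lt_succ_iff] using ht, ?_⟩
      rw [hcut]
      show g.lo k j * blockβ tm b + (Finset.range (b + 1)).inf' _ _ = _
      rw [heq]
    · intro t ht
      rw [hcut]
      show _ ≤ g.lo k j * blockβ tm b + (Finset.range (b + 1)).sup' _ _
      exact Nat.add_le_add_left (Finset.le_sup' (fun t => ((U t).stk k).length)
        (by simpa [Nat.lt_succ_iff] using ht)) _
    · obtain ⟨t, ht, heq⟩ := Finset.exists_mem_eq_sup' (s := Finset.range (b + 1)) (by simp)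
        (fun t => ((U t).stk k).length)
      refine ⟨t, by simpa [Nat.lt_succ_iff] using ht, ?_⟩
      rw [hcut]
      show g.lo k j * blockβ tm b + (Finset.range (b + 1)).sup' _ _ = _
      rw [heq]
    · rw [(h1 k).2]; exact h4 k
  obtain ⟨hfull, hl, hv, hht⟩ := correct_step hcorr hsim
  rw [hΓj1] at hl hv hht
  have hlo : ∀ k, g.lo k j = lo tm c₀ b k j := fun k => by
    rw [← (h1 k).1]; have := hfull.loC_eq k; rwa [hΓj] at this
  have hhi : ∀ k, g.hi k j = hi tm c₀ b k j := fun k => by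
    rw [← (h1 k).2]; have := hfull.hiC_eq k; rwa [hΓj] at this
  obtain ⟨-, hmn, hmx, hef⟩ := hfull
  rw [hΓj] at hmn hmx hef
  refine ⟨?_, fun k => ⟨hlo k, hhi k⟩⟩
  simp only [outOf, trueSummary, Summary.mk.injEq]
  refine ⟨hl, hv, funext fun k => hht k, funext fun k => hmn k, funext fun k => hmx k,
    funext fun k => ?_⟩
  rw [← hlo k]
  have := hef k
  rw [← hlo k] at this
  exact this

/-- **Soundness at node `j`** given goodness below: a non-FAIL value is the true summary and the
guess is right at `j`. [cite: Williams2025, §3.2] -/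
theorem sound_step {c₀ : tm.Cfg} {b : ℕ} {g : Walk tm} {j : ℕ} (hG : GoodBelow c₀ b g j)
    {s : Summary tm} (hs : dagVal c₀ b g j = some s) :
    s = trueSummary c₀ b j ∧ ∀ k, g.lo k j = lo tm c₀ b k j ∧ g.hi k j = hi tm c₀ b k j := by
  classical
  rw [dagVal_eq, prevT_eq_true hG] at hs
  change (if _ then _ else _) = some s at hs
  split_ifs at hs with hall
  · have hblk : ∀ k B, (childT c₀ b g j k B).getD [] =
        bpart (blockβ tm b) B ((run tm c₀ (j * b)).stk k) := fun k B => by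
      rw [childT_eq_true hG k B]; rfl
    rw [nodeFn_eq] at hs
    split_ifs at hs with hC
    · obtain ⟨hout, hg⟩ := node_sound _ hblk hC
      exact ⟨(Option.some.inj hs).symm.trans hout, hg⟩

/-- **Soundness (claim W, first half)** — for EVERY guessed walk `g` and every node `j`: a non-FAIL
value of node `j` is the true summary of time block `j`, and the guess agrees with the true walk at
`j` (Williams §3.2 "Graph Enumeration"/"Finishing up": a wrong guessed movement "will be detected
by the function `F_{h,i}`, which will then output FAIL. This FAIL value will propagate to the root").
Strong induction on `j` (topological order). [cite: Williams2025, §3.2] -/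
theorem claimW_sound (c₀ : tm.Cfg) (b : ℕ) (g : Walk tm) :
    ∀ j s, dagVal c₀ b g j = some s →
      s = trueSummary c₀ b j ∧ ∀ k, g.lo k j = lo tm c₀ b k j ∧ g.hi k j = hi tm c₀ b k j := by
  intro j
  induction j using Nat.strong_induction_on with
  | _ j ih =>
    intro s hs
    have hG : GoodBelow c₀ b g j := fun m hm => by
      have hne := dagVal_ne_none_of_lt c₀ b g (by rw [hs]; exact Option.some_ne_none s) m hm
      obtain ⟨sm, hsm⟩ := Option.ne_none_iff_exists'.1 hne
      obtain ⟨h1, h2⟩ := ih m hm sm hsm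
      exact ⟨by rw [hsm, h1], h2⟩
    exact sound_step hG hs

/-- **Williams's first bullet, as printed** ("If `G' ≠ G_{M',x}` … evaluating `R_{G'}` will result
in a special FAIL value at the root"): if the guess is wrong at some time block `m ≤ j`, node `j`
FAILs. [cite: Williams2025, §3.2] -/
theorem dagVal_eq_none_of_ne (c₀ : tm.Cfg) (b : ℕ) (g : Walk tm) {j m : ℕ} (hm : m ≤ j) (k : tm.K)
    (hne : g.lo k m ≠ lo tm c₀ b k m ∨ g.hi k m ≠ hi tm c₀ b k m) : dagVal c₀ b g j = none := by
  by_contra h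
  obtain ⟨s, hs⟩ := Option.ne_none_iff_exists'.1 h
  have hsm : dagVal c₀ b g m ≠ none := by
    rcases Nat.lt_or_ge m j with hlt | hge
    · exact dagVal_ne_none_of_lt c₀ b g h m hlt
    · obtain rfl : m = j := Nat.le_antisymm hm hge
      rw [hs]; exact Option.some_ne_none s
  obtain ⟨sm, hsm'⟩ := Option.ne_none_iff_exists'.1 hsm
  obtain ⟨-, hg⟩ := claimW_sound c₀ b g m sm hsm'
  rcases hne with hne | hne
  · exact hne (hg k).1
  · exact hne (hg k).2

end Sound

/-! ### Completeness -/

section Complete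

/-- The true walk's `lo`. [cite: Williams2025, §3.2] -/
theorem trueWalk_lo (c₀ : tm.Cfg) (b : ℕ) (k : tm.K) (j : ℕ) :
    (trueWalk c₀ b).lo k j = lo tm c₀ b k j := rfl

/-- The true walk's `hi`. [cite: Williams2025, §3.2] -/
theorem trueWalk_hi (c₀ : tm.Cfg) (b : ℕ) (k : tm.K) (j : ℕ) :
    (trueWalk c₀ b).hi k j = hi tm c₀ b k j := rfl

/-- **Under the true walk, with the true start data and the true blocks, the checks of `F_j` pass**
(the honest guess is never rejected; the bricks' completeness `condSim_trueClaims` /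
`true_run_eq_append` of [PaulEtAl1983, §3]). [cite: Williams2025, §3.2] -/
theorem checks_true (c₀ : tm.Cfg) (b j : ℕ) (blk : (k : tm.K) → ℕ → List (tm.Γ k))
    (hblk : ∀ k B, blk k B = bpart (blockβ tm b) B ((run tm c₀ (j * b)).stk k)) :
    Checks b (trueWalk c₀ b) j (trueStart c₀ b j) blk := by
  letI := tm.kDecidableEq
  have hcs := condSim_trueClaims c₀ b j
  obtain ⟨ha, hr, -, -, -, -, hf⟩ := hcs
  have hcov : ∀ k, ((run tm c₀ (j * b)).stk k).length ≤
      ((trueWalk c₀ b).hi k j + 1) * blockβ tm b := fun k => by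
    have := hf k
    simp only [hiC_trueClaims] at this
    simpa [trueClaims, trueWalk_hi] using this
  have hfrag : ∀ k, fragOf (trueWalk c₀ b) j blk k =
      above (lo tm c₀ b k j * blockβ tm b) ((run tm c₀ (j * b)).stk k) :=
    fragOf_eq_above blk hblk hcov
  have hstart : startOf (trueWalk c₀ b) j (trueStart c₀ b j) blk =
      (trueClaims tm c₀ b j).startCfg := by
    simp only [startOf, BlockClaim.startCfg, trueClaims, trueStart]
    congr 1
    funext k
    exact hfrag k
  -- heights across the block
  have htrue := true_run_eq_append c₀ b j
  have hL : ∀ k, (below (lo tm c₀ b k j * blockβ tm b) ((run tm c₀ (j * b)).stk k)).length =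
      lo tm c₀ b k j * blockβ tm b := fun k => length_below (cut_le_length c₀ b j k)
  have hlen : ∀ t, t ≤ b → ∀ k, ((run tm c₀ (j * b + t)).stk k).length =
      ((run tm (startOf (trueWalk c₀ b) j (trueStart c₀ b j) blk) t).stk k).length +
        lo tm c₀ b k j * blockβ tm b := by
    intro t ht k
    rw [hstart, htrue t ht, TM2Frames.appendBot_stk, List.length_append, hL]
  have hmn : ∀ k, mnOf b (trueWalk c₀ b) j (trueStart c₀ b j) blk k = minH tm c₀ b k j := by
    intro k
    unfold mnOf
    rw [trueWalk_lo]
    apply le_antisymm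
    · obtain ⟨d, hd, heq⟩ := Finset.exists_mem_eq_inf' (s := Finset.range (b + 1)) (by simp)
        (fun d => height tm c₀ k (j * b + d))
      have hd' : d ≤ b := by simpa [Nat.lt_succ_iff] using hd
      change minH tm c₀ b k j = height tm c₀ k (j * b + d) at heq
      unfold height at heq
      rw [hlen d hd' k] at heq
      rw [heq]
      have := Finset.inf'_le (fun t => ((run tm
        (startOf (trueWalk c₀ b) j (trueStart c₀ b j) blk) t).stk k).length) hd
      omega
    · obtain ⟨t, ht, heq⟩ := Finset.exists_mem_eq_inf' (s := Finset.range (b + 1)) (by simp)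
        (fun t => ((run tm (startOf (trueWalk c₀ b) j (trueStart c₀ b j) blk) t).stk k).length)
      have ht' : t ≤ b := by simpa [Nat.lt_succ_iff] using ht
      rw [heq]
      have := minH_le_height c₀ b k j t ht'
      unfold height at this
      rw [hlen t ht' k] at this
      omega
  have hmx : ∀ k, mxOf b (trueWalk c₀ b) j (trueStart c₀ b j) blk k = maxH tm c₀ b k j := by
    intro k
    unfold mxOf
    rw [trueWalk_lo]
    apply le_antisymm
    · obtain ⟨t, ht, heq⟩ := Finset.exists_mem_eq_sup' (s := Finset.range (b + 1)) (by simp)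
        (fun t => ((run tm (startOf (trueWalk c₀ b) j (trueStart c₀ b j) blk) t).stk k).length)
      have ht' : t ≤ b := by simpa [Nat.lt_succ_iff] using ht
      rw [heq]
      have := height_le_maxH c₀ b k j t ht'
      unfold height at this
      rw [hlen t ht' k] at this
      omega
    · obtain ⟨d, hd, heq⟩ := Finset.exists_mem_eq_sup' (s := Finset.range (b + 1)) (by simp)
        (fun d => height tm c₀ k (j * b + d))
      have hd' : d ≤ b := by simpa [Nat.lt_succ_iff] using hd
      change maxH tm c₀ b k j = height tm c₀ k (j * b + d) at heq
      unfold height at heq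
      rw [hlen d hd' k] at heq
      rw [heq]
      have := Finset.le_sup' (fun t => ((run tm
        (startOf (trueWalk c₀ b) j (trueStart c₀ b j) blk) t).stk k).length) hd
      omega
  refine ⟨fun k => ⟨?_, ?_⟩, fun k => ?_, fun k hk => ?_, hcov⟩
  · show (mnOf b (trueWalk c₀ b) j (trueStart c₀ b j) blk k - TM2Comp.machinePopBound tm -
        b * TM2Comp.machinePopBound tm) / blockβ tm b = lo tm c₀ b k j
    rw [hmn]; rfl
  · show (mxOf b (trueWalk c₀ b) j (trueStart c₀ b j) blk k + TM2Comp.machinePushBound tm) /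
        blockβ tm b = hi tm c₀ b k j
    rw [hmx]; rfl
  · rw [hfrag k, trueWalk_lo]
    have := ha k
    simp only [cutC_trueClaims] at this
    simpa [trueClaims, trueStart] using this
  · rw [hfrag k]
    rw [trueWalk_lo] at hk
    have := hr k
    simp only [loC_trueClaims] at this
    simpa [trueClaims] using this hk

/-- **Completeness (claim W, second half)** — under the TRUE walk every node `j` evaluates to the
true summary of time block `j`, no FAIL anywhere (Williams §3.2: "Assuming the current graph `G'` is
correct, i.e., `G' = G_{M',x}`, then the value of the root of `R_{G'}` is `content(1,B)` … can be
proved formally by an induction on the nodes of `G'` in topological order").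
[cite: Williams2025, §3.2] -/
theorem claimW_complete (c₀ : tm.Cfg) (b : ℕ) :
    ∀ j, dagVal c₀ b (trueWalk c₀ b) j = some (trueSummary c₀ b j) := by
  intro j
  induction j using Nat.strong_induction_on with
  | _ j ih =>
    classical
    have hG : GoodBelow c₀ b (trueWalk c₀ b) j := fun m hm => ⟨ih m hm, fun k => ⟨rfl, rfl⟩⟩
    rw [dagVal_eq, prevT_eq_true hG]
    change (if _ then _ else _) = _
    have hsome : ∀ k B, (childT c₀ b (trueWalk c₀ b) j k B).isSome := fun k B => by
      rw [childT_eq_true hG k B]; rfl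
    rw [if_pos (fun k B _ _ => hsome k B)]
    have hblk : ∀ k B, (childT c₀ b (trueWalk c₀ b) j k B).getD [] =
        bpart (blockβ tm b) B ((run tm c₀ (j * b)).stk k) := fun k B => by
      rw [childT_eq_true hG k B]; rfl
    have hC := checks_true c₀ b j _ hblk
    rw [nodeFn_eq, if_pos hC, (node_sound _ hblk hC).1]

end Complete

/-- **Claim W** (Williams 2025 §3.2, the two properties of the enumeration over guessed graphs,
"Graph Enumeration" p. 9: "If `G' ≠ G_{M',x}` … evaluating `R_{G'}` will result in a special FAIL
value at the root. If `G' = G_{M',x}`, then `R_{G'}` will evaluate to `content(1,B)` at the root"),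
in the stack rendering, for every machine, start configuration, block length and node `j`: for EVERY
guessed walk a non-FAIL value of node `j` is the true summary of time block `j` (soundness), and
under the true walk node `j` does evaluate to it (completeness). No hypothesis `b ≥ 1` is needed.
This is the typed rung-R2 target `ClaimW` of cell pnp-ideate (seat p3). [cite: Williams2025, §3.2] -/
theorem claimW (tm : FinTM2) (c₀ : tm.Cfg) (b : ℕ) (g : Walk tm) (j : ℕ) :
    (∀ s, dagVal c₀ b g j = some s → s = trueSummary c₀ b j) ∧
      dagVal c₀ b (trueWalk c₀ b) j = some (trueSummary c₀ b j) :=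
  ⟨fun s hs => (claimW_sound c₀ b g j s hs).1, claimW_complete c₀ b j⟩

end WilliamsGraph

end Literature.Computability.Complexity
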